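import Literature.Algebra.EuclideanLattices.GapCVPCoNPWitness
import Literature.Algebra.EuclideanLattices.GapSVPVerifier
import Mathlib.LinearAlgebra.Matrix.AbsoluteValue
import HarnessLib

/-!
# Completeness of the integer coNP certificate for `GapCVP_{c√n}`: reduction to the random-sample existence and the PSD-certificate algebra

Topic `Algebra/EuclideanLattices` (family `pqc`), continuing `GapCVPCoNPWitness.lean` (the integer
far-ness certificate `FarCert` for Aharonov–Regev 2005, Thm. 1.1, coNP part; soundness proved
there). Its completeness fact `FarCert.complete` (a VARIANT of AR05 §6.2) bundles three things of
different nature; this file separates them and PROVES the assembly, so that what remains are one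
statement of lattice-Gaussian analysis and one statement of exact linear algebra:

* `FarCert.sample_exists` (NAMED FACT, analysis — AR05 §6.2 proper, for the count test and the
  moment threshold of the tree's verifier): for a NO instance `((B, t), d)` of `GapCVP_{c₀√n}` there
  are `N ≤ poly` integer vectors `aⱼ = B wⱼ` (`wⱼ ∈ L*`) of polynomial bit size with MORE THAN A
  QUARTER of the phases `⟨wⱼ, t⟩ = aⱼ · (t adj B)/det B` at distance `≥ 1/8` from `ℤ`, and with the
  moment bound `20000 num² ‖A u‖² ≤ N den² ‖u B‖²` for all real `u` (i.e. `WᵀW ≼ N/(2s²)`,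
  `s = 100 d`). Printed ingredients: `f = E cos` (Claim 4.1), Lemma 3.1 (Banaszczyk 1.5), Lemmas
  2.5/2.6, 6.2 — in the tree: `GaussianLatticeSums.lean`, `GaussianLatticeTails.lean`,
  `GaussianLatticeMoments.lean` (all proved); what is not yet in the tree is the SAMPLING step
  (second-moment method over `N` independent samples of `D_{L*,1/s}`).
* `FarCert.psd_cert_exists` (NAMED FACT, exact linear algebra — Schrijver 1986, Thm. 3.3 /
  Cor. 3.3a: Gaussian elimination is polynomial, every number met is a quotient of subdeterminants;
  with Lagrange's four-square theorem): a symmetric positive semidefinite INTEGER matrix `Q` with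
  entries `≤ 2^S` has an exact certificate `σ² Q = RᵀR`, `R ∈ ℤ^{m×n}`, `m ≤ 4n`, `σ ≥ 1`, of bit
  size polynomial in `n + S` (rational `LDLᵀ` with symmetric pivoting, the nonnegative pivots written
  as four squares over a common denominator). Not printed in this form; recorded as a corollary.
* PROVED here: the sizes of `adj B`, `det B` (Hadamard-type bounds via Mathlib's `Matrix.det_le`:
  `natAbs_det_le_of_entries`, `natAbs_adjugate_le`), the symmetry and real positive
  semidefiniteness of the moment matrix from the moment bound (`cast_momentMatrix_quadForm`), the
  sizes of all data read off the instance code (`sizes_le_length_encode_gapCVP`), and the assembly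
  **`FarCert.complete_of : sample_exists → psd_cert_exists → complete`** (certificate
  `⟨N, A, adj B, det B, m, R, σ⟩`; `Accepts` by `adjugate_mul`/`mul_adjugate`; bit size polynomial).
  Hence (`gapSVP_sqrt_mem_promiseNP_inter_promiseCoNP_of_sample`) Cor. 1.2 is conditional on exactly
  `FarCert.verifier_mem_P`, `FarCert.sample_exists`, `FarCert.psd_cert_exists`.

## References

* D. Aharonov, O. Regev, *Lattice problems in NP ∩ coNP*, J. ACM 52 (2005) 749–765, §6.2.
* A. Schrijver, *Theory of Linear and Integer Programming*, Wiley 1986, §3.3 (Thm. 3.3, Cor. 3.3a: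
  sizes in Gaussian elimination).
* D. Micciancio, S. Goldwasser, *Complexity of Lattice Problems*, Kluwer 2002, Ch. 1 §1.3.
-/

noncomputable section

open Computability Literature.Computability.Complexity Literature.Computability.Complexity.Nondeterministic
open Matrix OracleCompose PRelSigPi Polynomial

namespace Literature.Algebra.EuclideanLattices

open GMSS

namespace FarCert

/-! ### The far count as a function of `(A, C, δ, t)` -/

/-- The integer phase `aⱼ · (t C)`. [cite: AharonovRegev2005, §6 test (a)] -/
def phaseOf {N n : ℕ} (A : Matrix (Fin N) (Fin n) ℤ) (C : Matrix (Fin n) (Fin n) ℤ) (t : Fin n → ℤ) (j : Fin N) : ℤ :=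
  A j ⬝ᵥ (t ᵥ* C)

/-- Far-ness of the `j`-th phase (distance of `pⱼ/δ` to `ℤ` at least `1/8`, integer form).
[cite: AharonovRegev2005, §6 test (a) (counting form)] -/
def FarOf {N n : ℕ} (A : Matrix (Fin N) (Fin n) ℤ) (C : Matrix (Fin n) (Fin n) ℤ) (δ : ℤ) (t : Fin n → ℤ) (j : Fin N) : Prop :=
  (δ.natAbs : ℤ) ≤ 8 * (phaseOf A C t j % δ.natAbs) ∧ (δ.natAbs : ℤ) ≤ 8 * (δ.natAbs - phaseOf A C t j % δ.natAbs)

/-- Far-ness is decidable. [folklore] -/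
instance {N n : ℕ} (A : Matrix (Fin N) (Fin n) ℤ) (C : Matrix (Fin n) (Fin n) ℤ) (δ : ℤ) (t : Fin n → ℤ) :
    DecidablePred (FarOf A C δ t) := fun _ => inferInstanceAs (Decidable (_ ∧ _))

/-- The number of far phases. [cite: AharonovRegev2005, §6 test (a)] -/
def farCountOf {N n : ℕ} (A : Matrix (Fin N) (Fin n) ℤ) (C : Matrix (Fin n) (Fin n) ℤ) (δ : ℤ) (t : Fin n → ℤ) : ℕ :=
  (Finset.univ.filter (FarOf A C δ t)).card

/-- The far count of a certificate depends only on `(A, C, δ)`. [folklore] -/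
theorem farCount_mk {n N m : ℕ} (A : Matrix (Fin N) (Fin n) ℤ) (C : Matrix (Fin n) (Fin n) ℤ) (δ : ℤ)
    (R : Matrix (Fin m) (Fin n) ℤ) (σ : ℕ) (t : Fin n → ℤ) :
    (FarCert.mk N A C δ m R σ).farCount t = farCountOf A C δ t := rfl

/-! ### The two remaining named facts -/

/-- **Existence of a good sample** (the ANALYTIC content of AR05 §6.2 for the tree's integer
verifier; NAMED FACT — variant, constants differ from print). There are `c₀ > 0` and a polynomial
`q` such that for every NO instance `((B, t), d)` of `GapCVP_{c₀√n}` (nonsingular `B ∈ ℤⁿˣⁿ`,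
`d > 0`, `dist(t, L(B)) > c₀ √n d`) there are `N ≤ q(|code|)` integer vectors `a₁, …, a_N ∈ ℤⁿ`
(rows of `A`), of entries `≤ 2^{q(|code|)}` in absolute value, such that (count test) more than
`N/4` of the phases `aⱼ · (t adj B)/det B` are at distance `≥ 1/8` from `ℤ`, and (moment test)
`20000 num(d)² ‖A u‖² ≤ N den(d)² ‖u B‖²` for every `u ∈ ℝⁿ`. Proof route (AR05 §6.2 with the
two extra steps recorded on `FarCert.complete`): `wⱼ` i.i.d. `D_{L*,1/s}`, `s = 100 d`,
`aⱼ = B wⱼ`; `E cos(2π⟨w, t⟩) = f_s(t) ≤ 10⁻²` for `dist(t, L) > 3 s √n` (`c₀ = 300`; tree: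
`tsum_gaussianFunction_sub_div_eq`, `tsum_gaussianFunction_sub_le_pow_mul_of_forall_le`) gives
`Pr[far] ≥ (cos(π/4) − f)/(1 + cos(π/4)) > 0.41`, and Chebyshev over `N ≥ 100` samples the count;
truncation at `‖w‖ ≤ 4√n/s` (Banaszczyk 1.5, tree: `GaussianLatticeTails.lean`) with the truncated
directional second moments `≤ π/(8 s²)` (tree: `tsum_gaussianFunction_mul_indicator_inner_sq_le`,
`GaussianLatticeMoments.lean`) and a Frobenius-norm second-moment bound give
`WᵀW ≼ N/(2 s²)` for `N = O(n²)` with probability `≥ 0.9`; entries `|aⱼₖ| ≤ ‖bₖ‖ · 4√n/s`.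
[cite: AharonovRegev2005, §6.2 (pp. 11–12): Claim 6.1, Lemmas 6.2–6.3 — variant for the integer verifier] -/
def sample_exists : Prop :=
  ∃ c₀ : ℝ, 0 < c₀ ∧ ∃ q : Polynomial ℕ, ∀ (I : LatticeInstance) (t : Fin I.n → ℤ) (d : ℚ),
    ((⟨I, t⟩ : CVPInstance), d) ∈ GapCVP.no (fun n => c₀ * Real.sqrt n) →
    ∃ (N : ℕ) (A : Matrix (Fin N) (Fin I.n) ℤ),
      N ≤ q.eval (gapCVPInstanceEncoding.encode ((⟨I, t⟩ : CVPInstance), d)).length ∧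
      (∀ j k, (A j k).natAbs ≤ 2 ^ q.eval (gapCVPInstanceEncoding.encode ((⟨I, t⟩ : CVPInstance), d)).length) ∧
      N < 4 * farCountOf A I.basis.adjugate I.basis.det t ∧
      ∀ u : Fin I.n → ℝ,
        20000 * (d.num : ℝ) ^ 2 * ((A.map (Int.cast : ℤ → ℝ) *ᵥ u) ⬝ᵥ (A.map (Int.cast : ℤ → ℝ) *ᵥ u)) ≤
          (N : ℝ) * (d.den : ℝ) ^ 2 *
            ((u ᵥ* I.basis.map (Int.cast : ℤ → ℝ)) ⬝ᵥ (u ᵥ* I.basis.map (Int.cast : ℤ → ℝ)))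

/-- **Exact positive-semidefiniteness certificates of polynomial size** (NAMED FACT; exact linear
algebra, a corollary of Schrijver 1986, Thm. 3.3 / Cor. 3.3a — "in Gaussian elimination each number
is a quotient of two subdeterminants of the input, hence of polynomially bounded size" — and
Lagrange's four-square theorem; not printed in this form). A symmetric integer `n × n` matrix `Q`
that is positive semidefinite over `ℝ`, with entries at most `2^S` in absolute value, admits
`R ∈ ℤ^{m×n}`, `m ≤ 4n`, and `σ ≥ 1` with `σ² Q = RᵀR`, all of bit size `≤ q(n + S)` for a fixed
polynomial `q`: rational `LDLᵀ` with symmetric pivoting (a PSD matrix with zero diagonal is zero),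
pivots `dₖ ≥ 0` written as four rational squares, one common denominator `σ`.
[cite: Schrijver1986, Thm. 3.3 and Cor. 3.3a (sizes in Gaussian elimination) — corollary with Lagrange's four squares] -/
def psd_cert_exists : Prop :=
  ∃ q : Polynomial ℕ, ∀ (n S : ℕ) (Q : Matrix (Fin n) (Fin n) ℤ), Qᵀ = Q →
    (∀ u : Fin n → ℝ, 0 ≤ u ⬝ᵥ (Q.map (Int.cast : ℤ → ℝ) *ᵥ u)) → (∀ i k, (Q i k).natAbs ≤ 2 ^ S) →
    ∃ (m : ℕ) (R : Matrix (Fin m) (Fin n) ℤ) (σ : ℕ), σ ≠ 0 ∧ ((σ : ℤ) ^ 2) • Q = Rᵀ * R ∧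
      m ≤ 4 * n ∧ σ.size ≤ q.eval (n + S) ∧ ∀ i k, (R i k).natAbs.size ≤ q.eval (n + S)

/-! ### Sizes of the adjugate and the determinant (Hadamard-type, via `Matrix.det_le`) -/

/-- `|det B| ≤ n! Mⁿ` for entries bounded by `M`. [folklore] -/
theorem natAbs_det_le_of_entries {n : ℕ} (B : Matrix (Fin n) (Fin n) ℤ) {M : ℕ} (hM : ∀ i k, (B i k).natAbs ≤ M) :
    B.det.natAbs ≤ n.factorial * M ^ n := by
  have h : ∀ i k, |B i k| ≤ (M : ℤ) := fun i k => by rw [Int.abs_eq_natAbs]; exact_mod_cast hM i k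
  have := abs_det_le B h
  rw [Int.abs_eq_natAbs] at this
  exact_mod_cast this

/-- `|adj B i k| ≤ n! (max M 1)ⁿ`: the adjugate entries are determinants of `B` with one row replaced
by a unit vector (`Matrix.adjugate_apply`). [folklore] -/
theorem natAbs_adjugate_le {n : ℕ} (B : Matrix (Fin n) (Fin n) ℤ) {M : ℕ} (hM : ∀ i k, (B i k).natAbs ≤ M) (i k : Fin n) :
    (B.adjugate i k).natAbs ≤ n.factorial * (max M 1) ^ n := by
  rw [Matrix.adjugate_apply]
  refine natAbs_det_le_of_entries _ fun a b => ?_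
  rw [Matrix.updateRow_apply]
  split_ifs
  · rw [Pi.single_apply]
    split_ifs <;> simp
  · exact (hM a b).trans (le_max_left _ _)

/-! ### Sizes read off the code of an instance -/

/-- The code of `((B, t), d)`, field by field. [folklore] -/
theorem gapCVP_encode_fields (I : LatticeInstance) (t : Fin I.n → ℤ) (d : ℚ) :
    gapCVPInstanceEncoding.encode ((⟨I, t⟩ : CVPInstance), d) =
      boolPair (boolPair (encodeNat I.n)
        (boolPair (boolPair (unaryEncodeNat (I.n * I.n)) (body (rowMajor I.n I.basis))) ((encodingIntVecFin I.n).encode t)))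
        (boolPair (boolPair [decide (d.num < 0)] (encodeNat d.num.natAbs)) (encodeNat d.den)) := by
  have hm : (encodingIntMatrixFin I.n).encode I.basis = boolPair (unaryEncodeNat (I.n * I.n)) (body (rowMajor I.n I.basis)) := by
    rw [matrix_encode_eq, body, foldr_boolPair_eq (fun c : List Bool => c), List.map_id']
  rw [← hm]
  rfl

/-- **Sizes against the code length** `L`: `n ≤ L`, `size n ≤ L`, `size |Bᵢₖ| ≤ L`,
`size |num d| ≤ L`, `size (den d) ≤ L`. [cite: MicciancioGoldwasser2002, Ch. 1 §1.3 (size of the input)] -/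
theorem sizes_le_length_encode_gapCVP (I : LatticeInstance) (t : Fin I.n → ℤ) (d : ℚ) :
    I.n ≤ (gapCVPInstanceEncoding.encode ((⟨I, t⟩ : CVPInstance), d)).length ∧
    I.n.size ≤ (gapCVPInstanceEncoding.encode ((⟨I, t⟩ : CVPInstance), d)).length ∧
    (∀ i k, (I.basis i k).natAbs.size ≤ (gapCVPInstanceEncoding.encode ((⟨I, t⟩ : CVPInstance), d)).length) ∧
    d.num.natAbs.size ≤ (gapCVPInstanceEncoding.encode ((⟨I, t⟩ : CVPInstance), d)).length ∧
    d.den.size ≤ (gapCVPInstanceEncoding.encode ((⟨I, t⟩ : CVPInstance), d)).length := by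
  set L := (gapCVPInstanceEncoding.encode ((⟨I, t⟩ : CVPInstance), d)).length with hL
  have hsplit : L = 2 * (2 * (encodeNat I.n).length + 2 + (2 * (2 * (unaryEncodeNat (I.n * I.n)).length + 2 +
      (body (rowMajor I.n I.basis)).length) + 2 + ((encodingIntVecFin I.n).encode t).length)) + 2 +
      (2 * (2 * 1 + 2 + (encodeNat d.num.natAbs).length) + 2 + (encodeNat d.den).length) := by
    rw [hL, gapCVP_encode_fields]
    simp only [length_boolPair, List.length_singleton]
  have hun : (unaryEncodeNat (I.n * I.n)).length = I.n * I.n := Literature.Computability.MetaComplexity.length_unaryEncodeNat _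
  have hsz : (encodeNat I.n).length = I.n.size := TM2Pass.length_encodeNat_eq_size _
  have hszn : (encodeNat d.num.natAbs).length = d.num.natAbs.size := TM2Pass.length_encodeNat_eq_size _
  have hszd : (encodeNat d.den).length = d.den.size := TM2Pass.length_encodeNat_eq_size _
  have hnn : I.n ≤ I.n * I.n := Nat.le_mul_self _
  refine ⟨by omega, by omega, fun i k => ?_, by omega, by omega⟩
  have hlt : (i : ℕ) * I.n + k < (rowMajor I.n I.basis).length := by
    rw [length_rowMajor]; exact lt_of_lt_of_le (by omega) (jn_add_n_le I.n i)
  have hmem : encodingIntBool.encode (I.basis i k) ∈ rowMajor I.n I.basis := by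
    rw [← getElem_rowMajor_entry I.basis i k hlt]; exact List.getElem_mem hlt
  have hlen := length_le_length_body hmem
  rw [length_encodingIntBool_encode, TM2Pass.length_encodeNat_eq_size] at hlen
  omega

/-! ### The moment matrix over `ℝ` -/

/-- The moment matrix is symmetric. [folklore] -/
theorem momentMatrix_transpose {n : ℕ} (c : FarCert n) (B : Matrix (Fin n) (Fin n) ℤ) (d : ℚ) :
    (c.momentMatrix B d)ᵀ = c.momentMatrix B d := by
  rw [momentMatrix, Matrix.transpose_sub, Matrix.transpose_smul, Matrix.transpose_smul, Matrix.transpose_mul,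
    Matrix.transpose_mul, Matrix.transpose_transpose, Matrix.transpose_transpose]

/-- **The real quadratic form of the moment matrix**:
`u · (Q u) = N den² ‖u B‖² − 20000 num² ‖A u‖²` over `ℝ`. [cite: AharonovRegev2005, §6.1] -/
theorem cast_momentMatrix_quadForm {n : ℕ} (c : FarCert n) (B : Matrix (Fin n) (Fin n) ℤ) (d : ℚ) (u : Fin n → ℝ) :
    u ⬝ᵥ ((c.momentMatrix B d).map (Int.cast : ℤ → ℝ) *ᵥ u) =
      (c.N : ℝ) * (d.den : ℝ) ^ 2 * ((u ᵥ* B.map (Int.cast : ℤ → ℝ)) ⬝ᵥ (u ᵥ* B.map (Int.cast : ℤ → ℝ))) -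
        20000 * (d.num : ℝ) ^ 2 * ((c.A.map (Int.cast : ℤ → ℝ) *ᵥ u) ⬝ᵥ (c.A.map (Int.cast : ℤ → ℝ) *ᵥ u)) := by
  have hQ : (c.momentMatrix B d).map (Int.cast : ℤ → ℝ) =
      ((c.N : ℝ) * (d.den : ℝ) ^ 2) • (B.map (Int.cast : ℤ → ℝ) * (B.map (Int.cast : ℤ → ℝ))ᵀ) -
        (20000 * (d.num : ℝ) ^ 2) • ((c.A.map (Int.cast : ℤ → ℝ))ᵀ * c.A.map (Int.cast : ℤ → ℝ)) := by
    ext i k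
    simp only [momentMatrix, Matrix.map_apply, Matrix.sub_apply, Matrix.smul_apply, smul_eq_mul, Matrix.mul_apply,
      Matrix.transpose_apply, Int.cast_sub, Int.cast_mul, Int.cast_sum, Int.cast_pow, Int.cast_natCast, Int.cast_ofNat]
  rw [hQ, Matrix.sub_mulVec, dotProduct_sub, Matrix.smul_mulVec, Matrix.smul_mulVec, dotProduct_smul, dotProduct_smul,
    smul_eq_mul, smul_eq_mul, ← Matrix.mulVec_mulVec, ← Matrix.mulVec_mulVec, Matrix.dotProduct_mulVec u (B.map _),
    Matrix.mulVec_transpose, Matrix.dotProduct_mulVec u (c.A.map _)ᵀ, Matrix.vecMul_transpose]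

/-- Entries of the moment matrix are bounded in terms of bounds on `B`, `A`. [folklore] -/
theorem natAbs_momentMatrix_le {n : ℕ} (c : FarCert n) (B : Matrix (Fin n) (Fin n) ℤ) (d : ℚ) {M K : ℕ}
    (hM : ∀ i k, (B i k).natAbs ≤ M) (hK : ∀ j k, (c.A j k).natAbs ≤ K) (i k : Fin n) :
    (c.momentMatrix B d i k).natAbs ≤ c.N * d.den ^ 2 * (n * M ^ 2) + 20000 * d.num.natAbs ^ 2 * (c.N * K ^ 2) := by
  have h1 : ((B * Bᵀ) i k).natAbs ≤ n * M ^ 2 := by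
    rw [Matrix.mul_apply]
    refine (Int.natAbs_sum_le _ _).trans ?_
    calc ∑ l, (B i l * Bᵀ l k).natAbs ≤ ∑ _l : Fin n, M ^ 2 := Finset.sum_le_sum fun l _ => by
          rw [Matrix.transpose_apply, Int.natAbs_mul, sq]; exact Nat.mul_le_mul (hM _ _) (hM _ _)
      _ = n * M ^ 2 := by simp
  have h2 : ((c.Aᵀ * c.A) i k).natAbs ≤ c.N * K ^ 2 := by
    rw [Matrix.mul_apply]
    refine (Int.natAbs_sum_le _ _).trans ?_
    calc ∑ j, (c.Aᵀ i j * c.A j k).natAbs ≤ ∑ _j : Fin c.N, K ^ 2 := Finset.sum_le_sum fun j _ => by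
          rw [Matrix.transpose_apply, Int.natAbs_mul, sq]; exact Nat.mul_le_mul (hK _ _) (hK _ _)
      _ = c.N * K ^ 2 := by simp
  rw [momentMatrix, Matrix.sub_apply, Matrix.smul_apply, Matrix.smul_apply, smul_eq_mul, smul_eq_mul]
  refine (Int.natAbs_sub_le _ _).trans ?_
  have h20 : ((20000 : ℤ)).natAbs = 20000 := rfl
  rw [Int.natAbs_mul, Int.natAbs_mul, Int.natAbs_mul, Int.natAbs_pow, Int.natAbs_mul, Int.natAbs_pow, h20]
  simp only [Int.natAbs_natCast]
  exact Nat.add_le_add (Nat.mul_le_mul_left _ h1) (Nat.mul_le_mul_left _ h2)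

/-! ### The assembly `complete ⇐ sample_exists ∧ psd_cert_exists` -/

/-- Double sums of bounded terms. [folklore] -/
theorem sum_sum_le_mul_mul {a b : ℕ} (f : Fin a → Fin b → ℕ) {K : ℕ} (h : ∀ i k, f i k ≤ K) :
    ∑ i, ∑ k, f i k ≤ a * (b * K) := by
  calc ∑ i, ∑ k, f i k ≤ ∑ _i : Fin a, ∑ _k : Fin b, K := Finset.sum_le_sum fun i _ => Finset.sum_le_sum fun k _ => h i k
    _ = a * (b * K) := by simp

/-- The size of `n! · (2^L)ⁿ`-type bounds: `size (n! Tⁿ) ≤ n size n + n size T + 2`. [folklore] -/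
theorem size_factorial_mul_pow_le (n T : ℕ) : (n.factorial * T ^ n).size ≤ n * n.size + n * T.size + 2 := by
  have h1 := size_mul_le n.factorial (T ^ n)
  have h2 := size_factorial_le n
  have h3 := size_pow_le T n
  omega

/-- The total bit-size polynomial of the certificate (in the code length `L`), given the entry
polynomial `q` of `sample_exists` and the size polynomial `q₂` of `psd_cert_exists`. [folklore] -/
def completePoly (q q₂ : Polynomial ℕ) : Polynomial ℕ :=
  q * X * X + X ^ 2 + 4 * X * X + 2 + q * X + 4 * X + q * X * X * (q * X + 1) +
    X * (X * (2 * X ^ 2 + X + 2)) + (2 * X ^ 2 + X + 2) +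
    4 * X * X * q₂.comp (X + (3 * (q * X) + 5 * X + 16)) + q₂.comp (X + (3 * (q * X) + 5 * X + 16))

/-- Evaluation of `completePoly`. [folklore] -/
theorem completePoly_eval (q q₂ : Polynomial ℕ) (L : ℕ) :
    (completePoly q q₂).eval L =
      q.eval L * L * L + L ^ 2 + 4 * L * L + 2 + q.eval L * L + 4 * L + q.eval L * L * L * (q.eval L * L + 1) +
        L * (L * (2 * L ^ 2 + L + 2)) + (2 * L ^ 2 + L + 2) +
        4 * L * L * q₂.eval (L + (3 * (q.eval L * L) + 5 * L + 16)) + q₂.eval (L + (3 * (q.eval L * L) + 5 * L + 16)) := by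
  simp [completePoly, Polynomial.eval_comp]

/-- **`FarCert.complete` from the two remaining facts.** For a NO instance of `GapCVP_{c₀√n}` take
`N, A` from `sample_exists`, `C = adj B`, `δ = det B` (`adjugate_mul`, `mul_adjugate`), the moment
matrix `Q` (symmetric, positive semidefinite over `ℝ` by the moment bound, entries `≤ 2^S` with
`S = 3 q(L) L + 5 L + 16`), and `(R, σ)` from `psd_cert_exists`; the certificate
`⟨N, A, adj B, det B, m, R, σ⟩` is accepted and has bit size `≤ completePoly q q₂ (L)`.
[cite: AharonovRegev2005, §6.2 (pp. 11–12) — variant for the integer verifier] -/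
theorem complete_of (h1 : sample_exists) (h2 : psd_cert_exists) : complete := by
  obtain ⟨c₀, hc₀, q, hsample⟩ := h1
  obtain ⟨q₂, hcert⟩ := h2
  refine ⟨c₀, hc₀, completePoly q q₂, ?_⟩
  rintro ⟨⟨I, t⟩, d⟩ hp
  have hI : I.IsNonsingular := hp.1
  obtain ⟨N, A, hN, hA, hcount, hmom⟩ := hsample I t d hp
  obtain ⟨hnL, hsn, hsB, hsnum, hsden⟩ := sizes_le_length_encode_gapCVP I t d
  have hLpos : 0 < (gapCVPInstanceEncoding.encode ((⟨I, t⟩ : CVPInstance), d)).length := by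
    rw [gapCVP_encode_fields, length_boolPair]; omega
  set L := (gapCVPInstanceEncoding.encode ((⟨I, t⟩ : CVPInstance), d)).length with hL
  -- numeric consequences of the size bounds
  have hB2 : ∀ i k, (I.basis i k).natAbs ≤ 2 ^ L := fun i k => (Nat.size_le.1 (hsB i k)).le
  have hnum2 : d.num.natAbs ≤ 2 ^ L := (Nat.size_le.1 hsnum).le
  have hden2 : d.den ≤ 2 ^ L := (Nat.size_le.1 hsden).le
  have hn2 : I.n ≤ 2 ^ L := hnL.trans Nat.lt_two_pow_self.le
  have hN2 : N ≤ 2 ^ (q.eval L) := hN.trans Nat.lt_two_pow_self.le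
  -- the moment matrix
  set c₁ : FarCert I.n := ⟨N, A, I.basis.adjugate, I.basis.det, 0, 0, 1⟩ with hc₁
  set Q := c₁.momentMatrix I.basis d with hQdef
  have hQt : Qᵀ = Q := momentMatrix_transpose _ _ _
  have hQpsd : ∀ u : Fin I.n → ℝ, 0 ≤ u ⬝ᵥ (Q.map (Int.cast : ℤ → ℝ) *ᵥ u) := fun u => by
    rw [hQdef, cast_momentMatrix_quadForm]
    have := hmom u
    change 20000 * (d.num : ℝ) ^ 2 * _ ≤ (c₁.N : ℝ) * (d.den : ℝ) ^ 2 * _ at this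
    linarith
  set S := 3 * (q.eval L * L) + 5 * L + 16 with hS
  have hQS : ∀ i k, (Q i k).natAbs ≤ 2 ^ S := by
    intro i k
    refine (natAbs_momentMatrix_le c₁ I.basis d hB2 hA i k).trans ?_
    change N * d.den ^ 2 * (I.n * (2 ^ L) ^ 2) + 20000 * d.num.natAbs ^ 2 * (N * (2 ^ q.eval L) ^ 2) ≤ 2 ^ S
    have e1 : N * d.den ^ 2 * (I.n * (2 ^ L) ^ 2) ≤ 2 ^ (q.eval L) * (2 ^ L) ^ 2 * (2 ^ L * (2 ^ L) ^ 2) :=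
      Nat.mul_le_mul (Nat.mul_le_mul hN2 (Nat.pow_le_pow_left hden2 2)) (Nat.mul_le_mul_right _ hn2)
    have e2 : 20000 * d.num.natAbs ^ 2 * (N * (2 ^ q.eval L) ^ 2) ≤ 2 ^ 15 * (2 ^ L) ^ 2 * (2 ^ (q.eval L) * (2 ^ q.eval L) ^ 2) :=
      Nat.mul_le_mul (Nat.mul_le_mul (by norm_num) (Nat.pow_le_pow_left hnum2 2)) (Nat.mul_le_mul_right _ hN2)
    have p1 : 2 ^ (q.eval L) * (2 ^ L) ^ 2 * (2 ^ L * (2 ^ L) ^ 2) = 2 ^ (q.eval L + 5 * L) := by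
      rw [← pow_mul, ← pow_add, ← pow_add, ← pow_add]; ring_nf
    have p2 : 2 ^ 15 * (2 ^ L) ^ 2 * (2 ^ (q.eval L) * (2 ^ q.eval L) ^ 2) = 2 ^ (15 + 2 * L + 3 * q.eval L) := by
      rw [← pow_mul, ← pow_mul, ← pow_add, ← pow_add, ← pow_add]; ring_nf
    rw [p1] at e1
    rw [p2] at e2
    have hqL : q.eval L ≤ q.eval L * L := Nat.le_mul_of_pos_right _ hLpos
    have f1 : 2 ^ (q.eval L + 5 * L) ≤ 2 ^ (S - 1) := Nat.pow_le_pow_right (by norm_num) (by omega)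
    have f2 : 2 ^ (15 + 2 * L + 3 * q.eval L) ≤ 2 ^ (S - 1) := Nat.pow_le_pow_right (by norm_num) (by omega)
    have hS1 : S - 1 + 1 = S := by omega
    have f3 : 2 ^ (S - 1) + 2 ^ (S - 1) = 2 ^ S := by
      rw [← two_mul, ← pow_succ', hS1]
    omega
  obtain ⟨m, R, σ, hσ, hRR, hm, hσs, hRs⟩ := hcert I.n S Q hQt hQpsd hQS
  set cert : FarCert I.n := ⟨N, A, I.basis.adjugate, I.basis.det, m, R, σ⟩ with hcert_def
  have hmm : cert.momentMatrix I.basis d = Q := rfl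
  have hacc : cert.Accepts ((⟨I, t⟩ : CVPInstance), d) := by
    refine ⟨hI, ?_, ?_, hσ, ?_, ?_⟩
    · exact Matrix.adjugate_mul I.basis
    · exact Matrix.mul_adjugate I.basis
    · change ((cert.σ : ℤ) ^ 2) • cert.momentMatrix I.basis d = cert.Rᵀ * cert.R
      rw [hmm]; exact hRR
    · change cert.N < 4 * cert.farCount t
      rw [hcert_def, farCount_mk]; exact hcount
  refine ⟨cert, hacc, ?_⟩
  · -- the bit size
    have hq₂ : q₂.eval (I.n + S) ≤ q₂.eval (L + (3 * (q.eval L * L) + 5 * L + 16)) := TM2Iter.eval_mono q₂ (by omega)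
    set V := q₂.eval (L + (3 * (q.eval L * L) + 5 * L + 16)) with hV
    -- sizes of the entries
    have sA : ∀ j k, (A j k).natAbs.size ≤ q.eval L + 1 := fun j k =>
      (Nat.size_le_size (hA j k)).trans (by rw [Nat.size_pow])
    have hTL : (2 ^ L).size = L + 1 := Nat.size_pow
    have hfac : (I.n.factorial * (2 ^ L) ^ I.n).size ≤ 2 * L ^ 2 + L + 2 := by
      have h0 := size_factorial_mul_pow_le I.n (2 ^ L)
      rw [hTL] at h0
      have h1 : I.n * I.n.size ≤ L * L := Nat.mul_le_mul hnL hsn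
      have h2 : I.n * (L + 1) ≤ L * (L + 1) := Nat.mul_le_mul_right _ hnL
      have h3 : L ^ 2 = L * L := sq L
      have h4 : L * (L + 1) = L * L + L := by ring
      rw [h4] at h2
      rw [h3]
      omega
    have hmax : max (2 ^ L) 1 = 2 ^ L := max_eq_left Nat.one_le_two_pow
    have sAdj : ∀ i k, (I.basis.adjugate i k).natAbs.size ≤ 2 * L ^ 2 + L + 2 := fun i k => by
      have h : (I.basis.adjugate i k).natAbs ≤ I.n.factorial * (2 ^ L) ^ I.n := by
        have := natAbs_adjugate_le I.basis hB2 i k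
        rwa [hmax] at this
      exact (Nat.size_le_size h).trans hfac
    have sDet : I.basis.det.natAbs.size ≤ 2 * L ^ 2 + L + 2 :=
      (Nat.size_le_size (natAbs_det_le_of_entries I.basis hB2)).trans hfac
    have sR : ∀ i k, (R i k).natAbs.size ≤ V := fun i k => (hRs i k).trans hq₂
    have sσ : σ.size ≤ V := hσs.trans hq₂
    -- the sums
    have sumA : ∑ j, ∑ k, (A j k).natAbs.size ≤ N * (I.n * (q.eval L + 1)) :=
      sum_sum_le_mul_mul (fun j k => (A j k).natAbs.size) sA
    have sumC : ∑ i, ∑ k, (I.basis.adjugate i k).natAbs.size ≤ I.n * (I.n * (2 * L ^ 2 + L + 2)) :=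
      sum_sum_le_mul_mul (fun i k => (I.basis.adjugate i k).natAbs.size) sAdj
    have sumR : ∑ i, ∑ k, (R i k).natAbs.size ≤ m * (I.n * V) :=
      sum_sum_le_mul_mul (fun i k => (R i k).natAbs.size) sR
    -- assemble
    rw [hcert_def]
    change N * I.n + I.n * I.n + m * I.n + 2 + N + m + (∑ j, ∑ k, (A j k).natAbs.size) +
        (∑ i, ∑ k, (I.basis.adjugate i k).natAbs.size) + I.basis.det.natAbs.size +
        (∑ i, ∑ k, (R i k).natAbs.size) + σ.size ≤ (completePoly q q₂).eval L
    rw [completePoly_eval, ← hV]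
    have t1 : N * I.n ≤ q.eval L * L := Nat.mul_le_mul hN hnL
    have t2 : I.n * I.n ≤ L * L := Nat.mul_le_mul hnL hnL
    have t5 : m ≤ 4 * L := hm.trans (Nat.mul_le_mul_left 4 hnL)
    have t3 : m * I.n ≤ 4 * L * L := Nat.mul_le_mul t5 hnL
    have hqL : q.eval L ≤ q.eval L * L := Nat.le_mul_of_pos_right _ hLpos
    have t6 : N * (I.n * (q.eval L + 1)) ≤ q.eval L * L * L * (q.eval L * L + 1) := by
      have a1 : N * (I.n * (q.eval L + 1)) ≤ q.eval L * (L * (q.eval L + 1)) :=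
        Nat.mul_le_mul hN (Nat.mul_le_mul_right _ hnL)
      have a2 : q.eval L ≤ q.eval L * L * L := hqL.trans (Nat.le_mul_of_pos_right _ hLpos)
      have a3 : L * (q.eval L + 1) ≤ L * (L * (q.eval L * L + 1)) := by
        refine Nat.mul_le_mul_left L ?_
        have e : L * (q.eval L * L + 1) = q.eval L * L * L + L := by ring
        rw [e]; omega
      calc N * (I.n * (q.eval L + 1)) ≤ q.eval L * (L * (q.eval L + 1)) := a1
        _ ≤ q.eval L * (L * (L * (q.eval L * L + 1))) := Nat.mul_le_mul_left _ a3
        _ = q.eval L * L * L * (q.eval L * L + 1) := by ring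
    have t7 : I.n * (I.n * (2 * L ^ 2 + L + 2)) ≤ L * (L * (2 * L ^ 2 + L + 2)) :=
      Nat.mul_le_mul hnL (Nat.mul_le_mul_right _ hnL)
    have t8 : m * (I.n * V) ≤ 4 * L * L * V := by
      calc m * (I.n * V) ≤ (4 * L) * (L * V) := Nat.mul_le_mul t5 (Nat.mul_le_mul_right _ hnL)
        _ = 4 * L * L * V := by ring
    have hsq : L ^ 2 = L * L := sq L
    have hqLL : q.eval L * L ≤ q.eval L * L * L := Nat.le_mul_of_pos_right _ hLpos
    linarith

end FarCert

/-- **Thm. 1.1, coNP part, from the machine, the sample and the certificate algebra.**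
[cite: AharonovRegev2005, Thm. 1.1 (p. 2) and §6] -/
theorem gapCVP_sqrt_mem_promiseCoNP_of_sample (hV : FarCert.verifier_mem_P) (h1 : FarCert.sample_exists)
    (h2 : FarCert.psd_cert_exists) : gapCVP_sqrt_mem_promiseCoNP :=
  gapCVP_sqrt_mem_promiseCoNP_of hV (FarCert.complete_of h1 h2)

/-- **Aharonov–Regev 2005, Cor. 1.2 — sharpest conditional form in the tree**: with the NP leaf
(`gapSVP_mem_promiseNP_holds`) and Lemma A.1 discharged and `complete_of` proved, the vendored fact
`gapSVP_sqrt_mem_promiseNP_inter_promiseCoNP` depends on exactly three named facts: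
`FarCert.verifier_mem_P` (TM2 machine), `FarCert.sample_exists` (lattice-Gaussian sampling),
`FarCert.psd_cert_exists` (exact PSD certificates of polynomial size).
[cite: AharonovRegev2005, Cor. 1.2 (p. 2), from Thm. 1.1 and Lemma A.1 (p. 14)] -/
theorem gapSVP_sqrt_mem_promiseNP_inter_promiseCoNP_of_sample (hV : FarCert.verifier_mem_P)
    (h1 : FarCert.sample_exists) (h2 : FarCert.psd_cert_exists) : gapSVP_sqrt_mem_promiseNP_inter_promiseCoNP :=
  gapSVP_sqrt_mem_promiseNP_inter_promiseCoNP_of_NP_of_coNP gapSVP_mem_promiseNP_holds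
    (gapCVP_sqrt_mem_promiseCoNP_of_sample hV h1 h2)

end Literature.Algebra.EuclideanLattices

end
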